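import Summits.BirchSwinnertonDyer.Rank1Residual.Additive.SignedTwistMinusTransverse
import Summits.BirchSwinnertonDyer.Rank1Residual.Additive.CyclotomicTowerSignedLocalDisjoint
import HarnessLib

/-!
# The PLUS side of B3's transversality, I: point level — `E⁺_W(n) ∩ (N_n + p^m W_n) ⊆ p^m W_n`
# (cell `bsd-potss`, seat `bsd-potss-ctrl` g2; the `W`-side core of the kernel route to the typed
# reading (L0⁺) `EvenBranchPlusLocalControlZeroAt` = Kobayashi's (9.33) at `n = 0`, TARGET.md v2
# §1.1 T-e2-r0; sibling of x1b's `SignedTwistMinusTransverse.lean` §1)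

HONEST FRAMING (cell `bsd-potss`, run/shared/lean/pub/bsd-potss/; FULL-BSD rank ≤ 1 programme,
tranche 1b): TOOL THEOREMS ONLY — no definition, no named Literature fact, no Summits-side fact
`def … : Prop`, no `sorry`, axioms standard; the generic binders (`hD`, `hκ₀`, `hidx`, the good
supersingular `a_p = 0` model `M`, `hU`) are x1b's (files 91–93) and are discharged in Kobayashi's
setting by the sequel; nothing is booked; no label / mark / count moves; nothing about (C1_η) or
`BSD(W, p)` of any pair is claimed.

## Setting (x1b's dictionary, files 91–93): `Ψ : W(ℚ̄_p) ≃ V(ℚ̄_p)` at `E = ℚ_p`, `ι = closureEmb ℚ_p`,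
## `V = C • W^{(c)}` with a good supersingular `a_p = 0` model `M`, `K₀ ∋ θ = √c`, `η` the character
## of `θ`, `κ` the `ℤ_p`-extension; `W_j = W(ℚ_j·ℚ_p)`, `E⁺_W(n) = signedLocalPointsOfEmb … 1 n`,
## `N_n = E⁻_W(n) ∩ ker Tr_{n/0}` (zero-clause minus points).

* §1 `localTransport_mem_towerSigned_one` — (D4b1⁺) the PLUS dictionary: `Ψ` maps `E⁺_W(n)` into
  cc-typer-6's `E⁺_V(K_{n,v})` (Def. 1.1 has no `m = −1` clause on the plus side, so no zero clause
  is needed; the minus version is x1b's `localTransport_mem_towerSigned`).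
* §2 **`exists_eq_pow_smul_of_plus_eq_zeroClause_add_pow_smul`** — if `A ∈ E⁺_W(n)`, `x ∈ N_n`,
  `D ∈ W_n` and `A = x + p^m • D`, then `A = p^m • A'` with `A' ∈ W_n`. Through `Ψ`:
  `ΨA ∈ E⁺_V(K_{n,v})` is `η`-odd (a `W`-point), `Ψx ∈ E⁻_V(K_{n,v})`, `ΨD ∈ V(K_{n,v})`; the tower
  DISJOINTNESS lemma `exists_eq_pow_nsmul_of_plus_eq_minus_add` (file
  `CyclotomicTowerSignedLocalDisjoint`; its inputs Prop. 8.12 ii) `hsum`/`hint` are KERNEL for the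
  good supersingular tower — `localFixedPointsOfEmb_le_sup_towerSigned_of_stab`,
  `inf_towerSigned_towerSubgroup_eq_top_padic` — and Prop. 8.7) gives `ΨA = p^m • S`; `S` is
  `η`-eigen because `V(K_{n,v})` has no `p`-power torsion, so `S = ΨA'` with `A' ∈ W_n`.

References: [Kobayashi2003] S. Kobayashi, Invent. Math. 152 (2003), §2 p. 4, Def. 1.1 (p. 2),
Prop. 8.7 (p. 16), Prop. 8.12 ii) (pp. 17–18), Def. 8.16 and Lemma 8.17 (p. 19), (9.33) (p. 26).
-/

noncomputable section

open scoped Classical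

open WeierstrassCurve Field

namespace Summit.BirchSwinnertonDyer.Rank1Residual.Additive.SignedTwist

open Literature.NumberTheory.EllipticCurves Literature.NumberTheory.GaloisRepresentations
  Literature.NumberTheory.EllipticCurves.Kobayashi2003 Literature.NumberTheory.EllipticCurves.ZpDescent
  Summit.BirchSwinnertonDyer.Rank1Residual.AdditivePotMult
  Summit.BirchSwinnertonDyer.Rank1Residual.Additive.PadicCyclotomicTower
  Summit.BirchSwinnertonDyer.Rank1Residual.Additive.StrictSignedCount
  ZpExtension
open scoped ContRepresentation

/-! ## §1 (D4b1⁺) the plus dictionary `E⁺_W(n) → E⁺_V(K_{n,v})` -/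

section Dictionary

variable (W : WeierstrassCurve ℚ) (K₀ : Type) [Field K₀] [NumberField K₀] {θ : K₀} {c : ℚ}
  (hθ : θ ∉ Set.range (algebraMap ℚ K₀)) (hc : θ ^ 2 = algebraMap ℚ K₀ c)
  {p : ℕ} [Fact p.Prime] (κ : ZpExtension ℚ p)
  {V : WeierstrassCurve ℚ} {C : VariableChange ℚ} (hCV : C • W.quadraticTwist c = V)
  {E : Type} [Field E] [Algebra ℚ E] (ι : AlgebraicClosure ℚ →ₐ[ℚ] AlgebraicClosure E)

/-- **(D4b1⁺) `E⁺_W(n) → E⁺_V(K_{n,v})`**: a point of Kobayashi's Def. 1.1 PLUS group in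
`W`-coordinates goes to cc-typer-6's verbatim plus group on the `V`-side (the plus side has NO
`m = −1` clause, §2 p. 4; the traces commute with `Ψ`, `localTransport_localTraceOfEmb`).
[cite: Kobayashi2003, §2 p. 4, Def. 1.1 (p. 2)] -/
theorem localTransport_mem_towerSigned_one
    (hD : ∀ g : absoluteGaloisGroup ℚ, ∃ τ : absoluteGaloisGroup E,
      (resGalOfEmb ι τ)⁻¹ * g ∈ towerTopSubgroup κ K₀)
    (hκ₀ : ∀ x, ∃ g ∈ galRange (K := ℚ) K₀, κ g = x) {n : ℕ} {P : localPoints W E}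
    (hP : P ∈ signedLocalPointsOfEmb κ ι W 1 n) :
    localTransport W K₀ hθ hc hCV E ι P ∈
      towerSignedLocalPointsOfEmb (towerSubgroup κ K₀) ι V 1 n := by
  have hPn : P ∈ localLayerPointsOfEmb κ ι W n := signedLocalPointsOfEmb_le κ ι W 1 n hP
  have hfixU : ∀ {m} {R : localPoints W E}, R ∈ localLayerPointsOfEmb κ ι W m →
      localTransport W K₀ hθ hc hCV E ι R ∈ localFixedPointsOfEmb ι V (towerSubgroup κ K₀ m) :=
    fun {m} {R} hR ↦ localTransport_mem_localFixedPointsOfEmb W K₀ hθ hc hCV ι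
      (towerSubgroup_le_galRange κ K₀ m)
      (localFixedPointsOfEmb_antitone ι W
        (fun σ hσ ↦ ((mem_towerSubgroup_iff κ K₀ m σ).mp hσ).1) hR)
  refine (mem_towerSignedLocalPointsOfEmb_iff _ ι V 1 n _).mpr ⟨hfixU hPn, fun m hm hε ↦ ?_,
    fun h ↦ absurd h (by decide)⟩
  rw [← localTransport_localTraceOfEmb W K₀ hθ hc κ hCV ι hD hκ₀ (m + 1) n hPn]
  exact hfixU ((mem_signedLocalPointsOfEmb_iff κ ι W 1 n P).mp hP |>.2 m hm hε)

end Dictionary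

/-! ## §2 Point level: `E⁺_W(n) ∩ (N_n + p^m W_n) ⊆ p^m W_n` -/

section Generic

variable (W : WeierstrassCurve ℚ) [W.IsElliptic] (K₀ : Type) [Field K₀] [NumberField K₀] {θ : K₀} {c : ℚ}
  (hθ : θ ∉ Set.range (algebraMap ℚ K₀)) (hc : θ ^ 2 = algebraMap ℚ K₀ c)
  {p : ℕ} [hp : Fact p.Prime] (κ : ZpExtension ℚ p)
  {V : WeierstrassCurve ℚ} [V.IsElliptic] {C : VariableChange ℚ} (hCV : C • W.quadraticTwist c = V)
  (η : absoluteGaloisGroup ℚ →* ℤˣ)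
  (hη : ∀ σ : absoluteGaloisGroup ℚ, η σ = 1 ↔ σ • rootInClosure K₀ θ = rootInClosure K₀ θ)

omit [W.IsElliptic] in
include hθ hc hCV hη in
/-- **PLUS DISJOINTNESS at the point level, `W`-side.** Under x1b's generic tower hypotheses: if
`A ∈ E⁺_W(n)`, `x ∈ N_n` (zero-clause minus), `D ∈ W_n` and `A = x + p^m • D`, then `A = p^m • A'`
for some `A' ∈ W_n`. Through `Ψ`: `ΨA ∈ E⁺_V(K_{n,v})` is `η`-odd, `Ψx ∈ E⁻_V(K_{n,v})`,
`ΨD ∈ V(K_{n,v})`, and the tower disjointness lemma (Prop. 8.12 ii): `hsum`, `hint` kernel for the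
good supersingular tower; Prop. 8.7) gives `ΨA = p^m • S`; `S` is `η`-eigen since `V(K_{n,v})` has
no `p`-power torsion. [cite: Kobayashi2003, Prop. 8.12 ii) (pp. 17–18), Def. 8.16 and Lemma 8.17 (p. 19), Prop. 8.7 (p. 16)] -/
theorem exists_eq_pow_smul_of_plus_eq_zeroClause_add_pow_smul
    (hD : ∀ g : absoluteGaloisGroup ℚ, ∃ τ : absoluteGaloisGroup ℚ_[p],
      (resGalOfEmb (closureEmb (K := ℚ) ℚ_[p]) τ)⁻¹ * g ∈ towerTopSubgroup κ K₀)
    (hκ₀ : ∀ x, ∃ g ∈ galRange (K := ℚ) K₀, κ g = x) [(galRange (K := ℚ) K₀).Normal]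
    (hidx : (galRange (K := ℚ) K₀).index ≤ p - 1) (hp2 : p ≠ 2)
    (M : WeierstrassCurve ℤ_[p]) [hE : (M.map PadicInt.Coe.ringHom).IsElliptic]
    [hEt : (M.map PadicInt.toZMod).IsElliptic]
    (htr : Literature.NumberTheory.EllipticCurves.HasseManin.tr (M.map PadicInt.toZMod) = 0)
    (hVM : M.baseChange (AlgebraicClosure ℚ_[p]) = V.baseChange (AlgebraicClosure ℚ_[p]))
    (hU : ∀ n, localSubgroupOfEmb (towerSubgroup κ K₀ n) (closureEmb (K := ℚ) ℚ_[p]) = stab p (n + 1))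
    {n : ℕ} (m : ℕ) {A x D : localPoints W ℚ_[p]}
    (hA : A ∈ signedLocalPointsOfEmb κ (closureEmb (K := ℚ) ℚ_[p]) W 1 n)
    (hx : x ∈ signedLocalPointsOfEmb κ (closureEmb (K := ℚ) ℚ_[p]) W (-1) n ⊓
      (localTraceOfEmb κ (closureEmb (K := ℚ) ℚ_[p]) W 0 n).ker)
    (hDn : D ∈ localLayerPointsOfEmb κ (closureEmb (K := ℚ) ℚ_[p]) W n) (hAxD : A = x + p ^ m • D) :
    ∃ A' ∈ localLayerPointsOfEmb κ (closureEmb (K := ℚ) ℚ_[p]) W n, A = p ^ m • A' := by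
  set ι := closureEmb (K := ℚ) ℚ_[p] with hι
  set Ψ := localTransport W K₀ hθ hc hCV ℚ_[p] ι with hΨ
  have hidx0 : (galRange (K := ℚ) K₀).index ≠ 0 := Subgroup.FiniteIndex.index_ne_zero
  have hΔ := isUnit_Δ_of_isElliptic_toZMod p M
  have hAp := hasseCoeff_mem_maximalIdeal_of_tr_eq_zero hp2 M htr
  have hlt := lt_half_sq_sub_one_of_le_sub_one hp2 hidx
  -- Prop. 8.12 ii) on the `V`-side at layer `n` (both halves kernel), Prop. 8.7 at layer `n`
  have hsum := localFixedPointsOfEmb_le_sup_towerSigned_of_stab (ι := ι) (W := V)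
    (U := towerSubgroup κ K₀) (M := M) hp2 htr (towerSubgroup_antitone κ K₀) hU hVM n
  have hint : towerSignedLocalPointsOfEmb (towerSubgroup κ K₀) ι V 1 n ⊓
      towerSignedLocalPointsOfEmb (towerSubgroup κ K₀) ι V (-1) n ≤ localFixedPointsOfEmb ι V ⊤ :=
    (inf_towerSigned_towerSubgroup_eq_top_padic κ K₀ ι V hp2 M hΔ hAp hVM hidx0 hlt n).le
  have htorsV : ∀ Q ∈ localFixedPointsOfEmb ι V (towerSubgroup κ K₀ n), p • Q = 0 → Q = 0 :=
    fun Q hQ h ↦ eq_zero_of_prime_pow_smul_eq_zero_localFixedPointsOfEmb_of_stab ι V (towerSubgroup κ K₀)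
      hp2 M hΔ hAp hVM hU n 1 Q hQ (by rwa [pow_one])
  -- `Ψ A ∈ E⁺_V(K_{n,v})`, `η`-odd
  have hAn : A ∈ localLayerPointsOfEmb κ ι W n := signedLocalPointsOfEmb_le κ ι W 1 n hA
  have hΨA : Ψ A ∈ towerSignedLocalPointsOfEmb (towerSubgroup κ K₀) ι V 1 n :=
    localTransport_mem_towerSigned_one W K₀ hθ hc κ hCV ι hD hκ₀ hA
  obtain ⟨-, hΨAη⟩ := localTransport_mem_localFixedPoints_and_eigen W K₀ hθ hc κ hCV ι η hη hAn
  obtain ⟨τ, hτker, hτ⟩ := exists_mem_localSubgroupOfEmb_ker_eta_eq_neg_one κ K₀ ι hθ hc η hη hD hκ₀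
  have hτn : τ ∈ localLayerSubgroupOfEmb κ ι n :=
    Subgroup.comap_mono (κ.kerSubgroup_le_layerSubgroup n) hτker
  have hτA : τ • Ψ A = -Ψ A := by
    rw [hΨAη τ hτn, hτ, Units.val_neg, Units.val_one, neg_one_zsmul]
  -- `Ψ x ∈ E⁻_V(K_{n,v})`, `Ψ D ∈ V(K_{n,v})`
  obtain ⟨hxs, hxk⟩ := AddSubgroup.mem_inf.mp hx
  have hΨx : Ψ x ∈ towerSignedLocalPointsOfEmb (towerSubgroup κ K₀) ι V (-1) n :=
    localTransport_mem_towerSigned W K₀ hθ hc κ hCV ι hD hκ₀ hxs ((AddMonoidHom.mem_ker).mp hxk)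
  have hΨD : Ψ D ∈ localFixedPointsOfEmb ι V (towerSubgroup κ K₀ n) :=
    (localTransport_mem_localFixedPoints_and_eigen W K₀ hθ hc κ hCV ι η hη hDn).1
  have heq : Ψ A = Ψ x + p ^ m • Ψ D := by rw [hAxD, map_add, map_nsmul]
  -- the tower disjointness lemma on the `V`-side
  obtain ⟨S, hS, hAS⟩ := exists_eq_pow_nsmul_of_plus_eq_minus_add (towerSubgroup κ K₀) ι V
    (towerSubgroup_antitone κ K₀) n hsum hint (hp.out.odd_of_ne_two hp2) m htorsV hΨA hτA hΨx hΨD heq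
  have hSn : S ∈ localFixedPointsOfEmb ι V (towerSubgroup κ K₀ n) :=
    towerSignedLocalPointsOfEmb_le (towerSubgroup κ K₀) ι V 1 n hS
  -- `S` is `η`-eigen: `p^m • (σS − η(σ)S) = 0` and `V(K_{n,v})` has no `p`-power torsion
  have hSη : ∀ σ ∈ localLayerSubgroupOfEmb κ ι n,
      σ • S = ((η (resGalOfEmb ι σ) : ℤˣ) : ℤ) • S := by
    intro σ hσ
    have h0 := eq_zero_of_prime_pow_smul_eq_zero_localFixedPointsOfEmb_of_stab ι V (towerSubgroup κ K₀)
      hp2 M hΔ hAp hVM hU n m (σ • S - ((η (resGalOfEmb ι σ) : ℤˣ) : ℤ) • S)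
      ((localFixedPointsOfEmb ι V _).sub_mem (smul_mem_localFixedPointsOfEmb ι V σ hSn)
        ((localFixedPointsOfEmb ι V _).zsmul_mem hSn _)) ?_
    · exact sub_eq_zero.mp h0
    · rw [smul_sub, smul_comm, ← hAS, smul_comm (p ^ m), ← hAS, hΨAη σ hσ, sub_self]
  refine ⟨Ψ.symm S, localTransport_symm_mem_localLayerPointsOfEmb W K₀ hθ hc κ hCV ι η hη hSη, ?_⟩
  apply Ψ.injective
  rw [map_nsmul, AddEquiv.apply_symm_apply, hAS]

end Generic

end Summit.BirchSwinnertonDyer.Rank1Residual.Additive.SignedTwist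

end
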